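import Summits.AnomalousDissipation.AnomalousDissipation.Theorems.ImpulseGridGridInjectionIdentity
import Literature.Analysis.FluidPDE.StokesTorusProofs
import Literature.Analysis.FunctionSpaces.TorusFourierCalculus
import Literature.Analysis.FunctionSpaces.TorusAxisAverage

/-!
# Route ImpulseGrid (AnomalousDissipation) — crux `GridThesis`, line `Sketch`: stub W8,
the integral clauses of the explicit AC/DC grid design

Supports item `stmt-AnomalousDissipation-1770`
(`Summit.AnomalousDissipation.AnomalousDissipation.Theses.ImpulseGrid.GridThesis`). For the explicit
design of the line — slab profile `Φ = 1 + 2θ cos 2πx₀ = 1 + 2θ Re e₍₁,₀,₀₎`, sawtooth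
`Ψ = (θ/π) sin 2πx₀`, the `x₀`-independent cellular two-mode Stokes pattern
`G = A[sin 2πm(x₁+x₂)·(e₁−e₂) + sin 2πm(x₁−x₂)·(e₁+e₂)]` (Stokes modes of frequencies `(0, m, ±m)`)
and the quadrature pair `C = cos(2πx₀)G`, `S = sin(2πx₀)G` — we prove
`∫ΦΨ|G|² = 0`, `∫Φ•G = 0`, `(Φ•G, C) = θ‖G‖₂²`, `(Φ•G, S) = 0`, `(Φ•G, G) = ‖G‖₂² > 0`.

Proof (one trick): the weight `|G|²` and `G` are invariant under every translation
`x ↦ x + s e₀` (both frequencies have vanishing `0`-th component, and the characters are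
eigenfunctions of the axis translations, `e_k(x + s eᵢ) = e_{kᵢ}(s) e_k(x)`), while a character
with `k₀ ≠ 0` changes sign under the half-period translation `s = 1/(2k₀)` (Mathlib's
`fourier_add_half_inv_index`). By translation invariance of the Haar measure
(`MeasureTheory.integral_add_right_eq_self`) every integrand (odd factor) × (invariant factor)
integrates to minus itself, hence to `0`: this kills `∫ cos(2πx₀)|G|²`, `∫ sin(2πx₀)|G|²`,
`∫ cos(2πx₀)•G` (frequency `e₀`, shift `½`) and `∫ cos(4πx₀)|G|²`, `∫ sin(4πx₀)|G|²`
(frequency `2e₀`, shift `¼`); the clauses follow from `cos² = ½(1 + cos 4πx₀)`,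
`sin·cos = ½ sin 4πx₀`, `|e_k| = 1`, the zero mean of Stokes modes (`hasZeroMean_stokesMode`)
and positivity of `∫|G|²` for the continuous field `G` with `G(¼m⁻¹ e₁) = 2A e₁ ≠ 0`.

No new definitions.

References: Constantin–Foias 1988, Ch. 4 (4.13) (Stokes eigenfields on the torus); Grafakos 2014,
§3.1.1 (characters of `T^d`).
-/

noncomputable section

-- `Summit.<Summit>.<Problem>` is the tree's mandated summit-side namespace (CONVENTIONS §2); for this
-- single-conjunct summit the two coincide, so the duplicate is deliberate.
set_option linter.dupNamespace false

open MeasureTheory Set Filter Topology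
open scoped InnerProductSpace RealInnerProductSpace

namespace Summit.AnomalousDissipation.AnomalousDissipation.Theorems

open Literature.Analysis.FluidPDE Literature.Analysis.FluidPDE.Torus
open Literature.Analysis.FunctionSpaces Literature.Analysis.FunctionSpaces.Torus

namespace AcdcDesign

/-! ### Translation tools on the torus -/

/-- A function on the torus that changes sign under some translation has integral zero
(translation invariance of the Haar measure; no integrability needed). [folklore] -/
theorem integral_eq_zero_of_forall_add_eq_neg {d : Type*} [Fintype d] {F' : Type*}
    [NormedAddCommGroup F'] [NormedSpace ℝ F'] (f : UnitAddTorus d → F') (t : UnitAddTorus d)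
    (h : ∀ x, f (x + t) = -f x) : ∫ x, f x = 0 := by
  have h1 : ∫ x, f (x + t) = ∫ x, f x := integral_add_right_eq_self f t
  simp_rw [h, integral_neg] at h1
  have h2 : (2 : ℝ) • ∫ x, f x = 0 := by
    rw [two_smul]
    nth_rewrite 1 [← h1]
    exact neg_add_cancel _
  exact (smul_eq_zero.mp h2).resolve_left two_ne_zero

/-- A character with vanishing `i`-th frequency is invariant under the `i`-th axis translations
(the characters are eigenfunctions of the axis translations, `Torus.mFourier_add_single`). [folklore] -/
theorem mFourier_add_single_of_eq_zero {d : Type*} [Fintype d] [DecidableEq d]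
    {k : d → ℤ} {i : d} (hk : k i = 0) (s : UnitAddCircle) (x : UnitAddTorus d) :
    UnitAddTorus.mFourier k (x + Pi.single i s) = UnitAddTorus.mFourier k x := by
  rw [mFourier_add_single, hk, fourier_zero, one_mul]

/-- A character with `kᵢ ≠ 0` changes sign under the half-period translation `x ↦ x + eᵢ/(2kᵢ)`
(`Torus.mFourier_add_single`, `Torus.fourier_half_inv`). [folklore] -/
theorem mFourier_add_single_half {d : Type*} [Fintype d] [DecidableEq d] {k : d → ℤ} {i : d}
    (hk : k i ≠ 0) (x : UnitAddTorus d) :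
    UnitAddTorus.mFourier k (x + Pi.single i (((1 : ℝ) / 2 / (k i : ℝ) : ℝ) : UnitAddCircle)) =
      -UnitAddTorus.mFourier k x := by
  rw [mFourier_add_single, fourier_half_inv hk, neg_one_mul]

/-- The sine Stokes mode unfolded: `stokesMode k a false x = Im e_k(x) • a`. [folklore] -/
theorem stokesMode_false_apply {d : Type*} [Fintype d] (k : d → ℤ) (a : EuclideanSpace ℝ d)
    (x : UnitAddTorus d) : stokesMode k a false x = (UnitAddTorus.mFourier k x).im • a :=
  rfl

/-- `∫|G|² > 0` for a continuous field with a non-zero value (the Haar measure of the torus is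
positive on open sets). [folklore] -/
theorem integral_norm_sq_pos {d : Type*} [Fintype d]
    {G : UnitAddTorus d → EuclideanSpace ℝ (Fin 3)} (hG : Continuous G) {x₀ : UnitAddTorus d}
    (hx : G x₀ ≠ 0) : 0 < ∫ x, ‖G x‖ ^ 2 :=
  Continuous.integral_pos_of_hasCompactSupport_nonneg_nonzero (x := x₀) ((hG.norm).pow 2)
    (HasCompactSupport.of_compactSpace _) (fun x => by positivity)
    (pow_ne_zero 2 (norm_ne_zero_iff.mpr hx))

/-! ### The design integrals for an abstract odd character and invariant pattern -/

/-- **The AC/DC design integrals, abstract form.** Let `e : T³ → ℂ` be continuous with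
`(Re e)² + (Im e)² = 1`, odd under a translation `t₂` and with `e²` odd under a translation `t₄`;
let `G` be continuous, invariant under both translations and of zero mean. Then with
`Φ = 1 + 2θ Re e`, `Ψ = (θ/π) Im e`, `C = (Re e) G`, `S = (Im e) G`:
`∫ΦΨ|G|² = 0`, `∫Φ•G = 0`, `(Φ•G, C) = θ∫|G|²`, `(Φ•G, S) = 0`, `(Φ•G, G) = ∫|G|²`
(odd × invariant integrands vanish, `integral_eq_zero_of_forall_add_eq_neg`; `Re² = ½(1 + Re e²)`,
`Re·Im = ½ Im e²`). [folklore] -/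
theorem design_integrals {θ : ℝ} {e : UnitAddTorus (Fin 3) → ℂ}
    {G : UnitAddTorus (Fin 3) → EuclideanSpace ℝ (Fin 3)} {t₂ t₄ : UnitAddTorus (Fin 3)}
    (hec : Continuous e) (hGc : Continuous G)
    (he₂ : ∀ x, e (x + t₂) = -e x) (he₄ : ∀ x, e (x + t₄) * e (x + t₄) = -(e x * e x))
    (hn : ∀ x, (e x).re ^ 2 + (e x).im ^ 2 = 1)
    (hG₂ : ∀ x, G (x + t₂) = G x) (hG₄ : ∀ x, G (x + t₄) = G x) (hG0 : ∫ x, G x = 0) :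
    (∫ x, (1 + 2 * θ * (e x).re) * (θ / Real.pi * (e x).im) * ‖G x‖ ^ 2 = 0) ∧
    HasZeroMean (fun x => (1 + 2 * θ * (e x).re) • G x) ∧
    (∫ x, ⟪(1 + 2 * θ * (e x).re) • G x, (e x).re • G x⟫ = θ * ∫ x, ‖G x‖ ^ 2) ∧
    (∫ x, ⟪(1 + 2 * θ * (e x).re) • G x, (e x).im • G x⟫ = 0) ∧
    (∫ x, ⟪(1 + 2 * θ * (e x).re) • G x, G x⟫ = ∫ x, ‖G x‖ ^ 2) := by
  -- continuity of the building blocks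
  have hre : Continuous fun x => (e x).re := Complex.continuous_re.comp hec
  have him : Continuous fun x => (e x).im := Complex.continuous_im.comp hec
  have hre2 : Continuous fun x => (e x * e x).re := Complex.continuous_re.comp (hec.mul hec)
  have him2 : Continuous fun x => (e x * e x).im := Complex.continuous_im.comp (hec.mul hec)
  have hw : Continuous fun x => ‖G x‖ ^ 2 := (hGc.norm).pow 2
  -- the odd integrals vanish
  have I1 : ∫ x, (e x).re * ‖G x‖ ^ 2 = 0 :=
    integral_eq_zero_of_forall_add_eq_neg _ t₂ fun x => by rw [he₂, hG₂, Complex.neg_re, neg_mul]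
  have I2 : ∫ x, (e x).im * ‖G x‖ ^ 2 = 0 :=
    integral_eq_zero_of_forall_add_eq_neg _ t₂ fun x => by rw [he₂, hG₂, Complex.neg_im, neg_mul]
  have I3 : ∫ x, (e x).re • G x = 0 :=
    integral_eq_zero_of_forall_add_eq_neg _ t₂ fun x => by rw [he₂, hG₂, Complex.neg_re, neg_smul]
  have I4 : ∫ x, (e x * e x).re * ‖G x‖ ^ 2 = 0 :=
    integral_eq_zero_of_forall_add_eq_neg _ t₄ fun x => by rw [he₄, hG₄, Complex.neg_re, neg_mul]
  have I5 : ∫ x, (e x * e x).im * ‖G x‖ ^ 2 = 0 :=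
    integral_eq_zero_of_forall_add_eq_neg _ t₄ fun x => by rw [he₄, hG₄, Complex.neg_im, neg_mul]
  -- integrability (continuous functions on the compact torus)
  have i1 : Integrable (fun x => (e x).re * ‖G x‖ ^ 2) volume := (hre.mul hw).integrable_unitAddTorus
  have i2 : Integrable (fun x => (e x).im * ‖G x‖ ^ 2) volume := (him.mul hw).integrable_unitAddTorus
  have i4 : Integrable (fun x => θ * ((e x * e x).re * ‖G x‖ ^ 2)) volume :=
    (continuous_const.mul (hre2.mul hw)).integrable_unitAddTorus
  have i5 : Integrable (fun x => θ * ((e x * e x).im * ‖G x‖ ^ 2)) volume :=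
    (continuous_const.mul (him2.mul hw)).integrable_unitAddTorus
  have iw : Integrable (fun x => ‖G x‖ ^ 2) volume := hw.integrable_unitAddTorus
  refine ⟨?_, ?_, ?_, ?_, ?_⟩
  · -- `∫ΦΨ|G|² = (θ/π)∫ Im e |G|² + (θ²/π) ∫ Im e² |G|² = 0`
    have hpt : ∀ x, (1 + 2 * θ * (e x).re) * (θ / Real.pi * (e x).im) * ‖G x‖ ^ 2 =
        θ / Real.pi * ((e x).im * ‖G x‖ ^ 2) + θ ^ 2 / Real.pi * ((e x * e x).im * ‖G x‖ ^ 2) := by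
      intro x
      rw [Complex.mul_im]
      ring
    have ia : Integrable (fun x => θ / Real.pi * ((e x).im * ‖G x‖ ^ 2)) volume := i2.const_mul _
    have ib : Integrable (fun x => θ ^ 2 / Real.pi * ((e x * e x).im * ‖G x‖ ^ 2)) volume :=
      (continuous_const.mul (him2.mul hw)).integrable_unitAddTorus
    simp_rw [hpt]
    rw [integral_add ia ib, integral_const_mul, integral_const_mul, I2, I5]
    ring
  · -- `∫Φ•G = ∫G + 2θ ∫ (Re e)•G = 0`
    unfold HasZeroMean
    have hpt : ∀ x, (1 + 2 * θ * (e x).re) • G x = G x + (2 * θ) • ((e x).re • G x) := by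
      intro x
      rw [add_smul, one_smul, mul_smul]
    have ia : Integrable (fun x => (2 * θ) • ((e x).re • G x)) volume :=
      Continuous.integrable_unitAddTorus (by fun_prop)
    simp_rw [hpt]
    rw [integral_add hGc.integrable_unitAddTorus ia, integral_smul, I3, hG0, smul_zero, add_zero]
  · -- `(Φ•G, C) = ∫ Re e |G|² + θ∫|G|² + θ∫ Re e² |G|² = θ∫|G|²`
    have hpt : ∀ x, ⟪(1 + 2 * θ * (e x).re) • G x, (e x).re • G x⟫ =
        (e x).re * ‖G x‖ ^ 2 + θ * ‖G x‖ ^ 2 + θ * ((e x * e x).re * ‖G x‖ ^ 2) := by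
      intro x
      rw [real_inner_smul_left, real_inner_smul_right, real_inner_self_eq_norm_sq, Complex.mul_re]
      linear_combination (θ * ‖G x‖ ^ 2) * hn x
    have ia : Integrable (fun x => θ * ‖G x‖ ^ 2) volume := iw.const_mul _
    have iab : Integrable (fun x => (e x).re * ‖G x‖ ^ 2 + θ * ‖G x‖ ^ 2) volume := i1.add ia
    simp_rw [hpt]
    rw [integral_add iab i4, integral_add i1 ia, integral_const_mul, integral_const_mul, I1, I4]
    ring
  · -- `(Φ•G, S) = ∫ Im e |G|² + θ∫ Im e² |G|² = 0`
    have hpt : ∀ x, ⟪(1 + 2 * θ * (e x).re) • G x, (e x).im • G x⟫ =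
        (e x).im * ‖G x‖ ^ 2 + θ * ((e x * e x).im * ‖G x‖ ^ 2) := by
      intro x
      rw [real_inner_smul_left, real_inner_smul_right, real_inner_self_eq_norm_sq, Complex.mul_im]
      ring
    simp_rw [hpt]
    rw [integral_add i2 i5, integral_const_mul, I2, I5]
    ring
  · -- `(Φ•G, G) = ∫|G|² + 2θ ∫ Re e |G|² = ∫|G|²`
    have hpt : ∀ x, ⟪(1 + 2 * θ * (e x).re) • G x, G x⟫ =
        ‖G x‖ ^ 2 + 2 * θ * ((e x).re * ‖G x‖ ^ 2) := by
      intro x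
      rw [real_inner_smul_left, real_inner_self_eq_norm_sq]
      ring
    have ia : Integrable (fun x => 2 * θ * ((e x).re * ‖G x‖ ^ 2)) volume := i1.const_mul _
    simp_rw [hpt]
    rw [integral_add iw ia, integral_const_mul, I1]
    ring

end AcdcDesign

/-- **Stub W8 of crux `GridThesis` (item stmt-AnomalousDissipation-1770), line `Sketch`: the
integral clauses of the explicit AC/DC design.** For `Φ = 1 + 2θ cos 2πx₀`, `Ψ = (θ/π) sin 2πx₀`,
`G = A[sin 2πm(x₁+x₂)·(e₁−e₂) + sin 2πm(x₁−x₂)·(e₁+e₂)]`, `C = cos(2πx₀)G`, `S = sin(2πx₀)G`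
with `m ≥ 1`, `A > 0`: `∫ΦΨ|G|² = 0`, `∫Φ•G = 0`, `(Φ•G, C) = θ‖G‖₂²`, `(Φ•G, S) = 0`,
`(Φ•G, G) = ‖G‖₂² > 0` (`AcdcDesign.design_integrals` with `e = e_{e₀}`, odd under `x₀ ↦ x₀ + ½`,
`e²` odd under `x₀ ↦ x₀ + ¼`, `G` `x₀`-invariant with zero mean; positivity from
`G(e₁/(4m)) = 2A e₁ ≠ 0`). [folklore] -/
theorem stub_acdcDesignIntegrals :
    ∀ (m : ℕ) (A θ : ℝ) (Φ Ψ : UnitAddTorus (Fin 3) → ℝ)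
      (G C S : UnitAddTorus (Fin 3) → EuclideanSpace ℝ (Fin 3)),
      Φ = (fun x => 1 + 2 * θ * (UnitAddTorus.mFourier (Pi.single (0 : Fin 3) (1 : ℤ)) x).re) →
      Ψ = (fun x => θ / Real.pi * (UnitAddTorus.mFourier (Pi.single (0 : Fin 3) (1 : ℤ)) x).im) →
      G = (fun x => A • (stokesMode ![(0 : ℤ), (m : ℤ), (m : ℤ)] (EuclideanSpace.single (1 : Fin 3) (1 : ℝ) - EuclideanSpace.single (2 : Fin 3) (1 : ℝ)) false x +
          stokesMode ![(0 : ℤ), (m : ℤ), -(m : ℤ)] (EuclideanSpace.single (1 : Fin 3) (1 : ℝ) + EuclideanSpace.single (2 : Fin 3) (1 : ℝ)) false x)) →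
      C = (fun x => (UnitAddTorus.mFourier (Pi.single (0 : Fin 3) (1 : ℤ)) x).re • G x) → S = (fun x => (UnitAddTorus.mFourier (Pi.single (0 : Fin 3) (1 : ℤ)) x).im • G x) →
      1 ≤ m → 0 < A → 0 < θ →
      (∫ x, Φ x * Ψ x * ‖G x‖ ^ 2 = 0) ∧ HasZeroMean (fun x => Φ x • G x) ∧
      (∫ x, ⟪Φ x • G x, C x⟫ = θ * ∫ x, ‖G x‖ ^ 2) ∧ (∫ x, ⟪Φ x • G x, S x⟫ = 0) ∧
      (∫ x, ⟪Φ x • G x, G x⟫ = ∫ x, ‖G x‖ ^ 2) ∧ (0 < ∫ x, ‖G x‖ ^ 2) := by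
  intro m A θ Φ Ψ G C S hΦd hΨd hGd hCd hSd hm hA _hθ
  -- the two frequencies `(0, m, ±m)` are non-zero and have vanishing `0`-th component
  have hkp : (![(0 : ℤ), (m : ℤ), (m : ℤ)] : Fin 3 → ℤ) ≠ 0 := by
    intro h
    have h1 := congrFun h 1
    simp at h1
    omega
  have hkm : (![(0 : ℤ), (m : ℤ), -(m : ℤ)] : Fin 3 → ℤ) ≠ 0 := by
    intro h
    have h1 := congrFun h 1
    simp at h1
    omega
  -- the pattern `G`: pointwise formula, continuity, `x₀`-invariance, zero mean
  have hGx : ∀ x, G x = A • (stokesMode ![(0 : ℤ), (m : ℤ), (m : ℤ)]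
      (EuclideanSpace.single (1 : Fin 3) (1 : ℝ) - EuclideanSpace.single (2 : Fin 3) (1 : ℝ)) false x +
      stokesMode ![(0 : ℤ), (m : ℤ), -(m : ℤ)]
      (EuclideanSpace.single (1 : Fin 3) (1 : ℝ) + EuclideanSpace.single (2 : Fin 3) (1 : ℝ)) false x) :=
    fun x => by rw [hGd]
  have hc1 := (stokesMode (d := Fin 3) ![(0 : ℤ), (m : ℤ), (m : ℤ)]
    (EuclideanSpace.single (1 : Fin 3) (1 : ℝ) - EuclideanSpace.single (2 : Fin 3) (1 : ℝ)) false).continuous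
  have hc2 := (stokesMode (d := Fin 3) ![(0 : ℤ), (m : ℤ), -(m : ℤ)]
    (EuclideanSpace.single (1 : Fin 3) (1 : ℝ) + EuclideanSpace.single (2 : Fin 3) (1 : ℝ)) false).continuous
  have hGc : Continuous G := by
    rw [hGd]
    exact (hc1.add hc2).const_smul A
  have hGinv : ∀ (s : UnitAddCircle) (x : UnitAddTorus (Fin 3)), G (x + Pi.single 0 s) = G x := by
    intro s x
    rw [hGx, hGx, AcdcDesign.stokesMode_false_apply, AcdcDesign.stokesMode_false_apply,
      AcdcDesign.stokesMode_false_apply, AcdcDesign.stokesMode_false_apply,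
      AcdcDesign.mFourier_add_single_of_eq_zero
        (show (![(0 : ℤ), (m : ℤ), (m : ℤ)] : Fin 3 → ℤ) 0 = 0 from rfl),
      AcdcDesign.mFourier_add_single_of_eq_zero
        (show (![(0 : ℤ), (m : ℤ), -(m : ℤ)] : Fin 3 → ℤ) 0 = 0 from rfl)]
  have hG0 : ∫ x, G x = 0 := by
    have h1 := hasZeroMean_stokesMode hkp
      (EuclideanSpace.single (1 : Fin 3) (1 : ℝ) - EuclideanSpace.single (2 : Fin 3) (1 : ℝ)) false
    have h2 := hasZeroMean_stokesMode hkm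
      (EuclideanSpace.single (1 : Fin 3) (1 : ℝ) + EuclideanSpace.single (2 : Fin 3) (1 : ℝ)) false
    unfold HasZeroMean at h1 h2
    simp_rw [hGx]
    rw [integral_smul, integral_add hc1.integrable_unitAddTorus hc2.integrable_unitAddTorus, h1, h2,
      add_zero, smul_zero]
  -- a non-zero value: `G(e₁/(4m)) = 2A e₁`
  have hm0 : (m : ℝ) ≠ 0 := by exact_mod_cast (show m ≠ 0 by omega)
  have hchar : ∀ k : Fin 3 → ℤ, k 1 = (m : ℤ) →
      (UnitAddTorus.mFourier k
        (Pi.single (1 : Fin 3) (((1 : ℝ) / 4 / (m : ℝ) : ℝ) : UnitAddCircle) : UnitAddTorus (Fin 3))).im = 1 := by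
    intro k hk1
    rw [show (Pi.single (1 : Fin 3) (((1 : ℝ) / 4 / (m : ℝ) : ℝ) : UnitAddCircle) : UnitAddTorus (Fin 3)) =
        0 + Pi.single (1 : Fin 3) (((1 : ℝ) / 4 / (m : ℝ) : ℝ) : UnitAddCircle) from (zero_add _).symm,
      mFourier_add_single, show UnitAddTorus.mFourier k (0 : UnitAddTorus (Fin 3)) = 1 by
        simp [UnitAddTorus.mFourier], mul_one, hk1, fourier_coe_apply]
    have harg : (2 * (Real.pi : ℂ) * Complex.I * ((m : ℤ) : ℂ) * (((1 : ℝ) / 4 / (m : ℝ) : ℝ) : ℂ) /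
        ((1 : ℝ) : ℂ)) = ((Real.pi / 2 : ℝ) : ℂ) * Complex.I := by
      have hmC : (m : ℂ) ≠ 0 := by exact_mod_cast (show m ≠ 0 by omega)
      push_cast
      field_simp
      ring
    rw [harg, Complex.exp_im]
    simp
  have hx₀ : G (Pi.single (1 : Fin 3) (((1 : ℝ) / 4 / (m : ℝ) : ℝ) : UnitAddCircle)) =
      (A * 2) • EuclideanSpace.single (1 : Fin 3) (1 : ℝ) := by
    rw [hGx, AcdcDesign.stokesMode_false_apply, AcdcDesign.stokesMode_false_apply, hchar _ rfl,
      hchar _ rfl, one_smul, one_smul, sub_add_add_cancel, ← two_smul ℝ, smul_smul]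
  have hne : G (Pi.single (1 : Fin 3) (((1 : ℝ) / 4 / (m : ℝ) : ℝ) : UnitAddCircle)) ≠ 0 := by
    rw [hx₀]
    refine smul_ne_zero (by positivity) ?_
    intro h
    have h1 := congrArg (fun v : EuclideanSpace ℝ (Fin 3) => v 1) h
    simp at h1
  -- the character `e = e_{e₀}`: odd under `x₀ ↦ x₀ + ½`, `e²` odd under `x₀ ↦ x₀ + ¼`
  have hk1 : (Pi.single (0 : Fin 3) (1 : ℤ) : Fin 3 → ℤ) 0 ≠ 0 := by simp
  have hk2 : (Pi.single (0 : Fin 3) (1 : ℤ) + Pi.single (0 : Fin 3) (1 : ℤ) : Fin 3 → ℤ) 0 ≠ 0 := by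
    simp
  have he₂ := AcdcDesign.mFourier_add_single_half hk1
  have he₄ : ∀ x : UnitAddTorus (Fin 3),
      UnitAddTorus.mFourier (Pi.single (0 : Fin 3) (1 : ℤ)) (x + Pi.single (0 : Fin 3)
          (((1 : ℝ) / 2 / ((Pi.single (0 : Fin 3) (1 : ℤ) + Pi.single (0 : Fin 3) (1 : ℤ) :
            Fin 3 → ℤ) 0 : ℝ) : ℝ) : UnitAddCircle)) *
        UnitAddTorus.mFourier (Pi.single (0 : Fin 3) (1 : ℤ)) (x + Pi.single (0 : Fin 3)
          (((1 : ℝ) / 2 / ((Pi.single (0 : Fin 3) (1 : ℤ) + Pi.single (0 : Fin 3) (1 : ℤ) :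
            Fin 3 → ℤ) 0 : ℝ) : ℝ) : UnitAddCircle)) =
      -(UnitAddTorus.mFourier (Pi.single (0 : Fin 3) (1 : ℤ)) x *
        UnitAddTorus.mFourier (Pi.single (0 : Fin 3) (1 : ℤ)) x) := by
    intro x
    rw [← UnitAddTorus.mFourier_add, ← UnitAddTorus.mFourier_add, AcdcDesign.mFourier_add_single_half hk2]
  have hn : ∀ x : UnitAddTorus (Fin 3), (UnitAddTorus.mFourier (Pi.single (0 : Fin 3) (1 : ℤ)) x).re ^ 2 +
      (UnitAddTorus.mFourier (Pi.single (0 : Fin 3) (1 : ℤ)) x).im ^ 2 = 1 := by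
    intro x
    have h : ‖UnitAddTorus.mFourier (Pi.single (0 : Fin 3) (1 : ℤ)) x‖ = 1 := by
      simp [UnitAddTorus.mFourier, fourier_apply]
    have h2 : Complex.normSq (UnitAddTorus.mFourier (Pi.single (0 : Fin 3) (1 : ℤ)) x) = 1 := by
      rw [← Complex.sq_norm, h, one_pow]
    rw [Complex.normSq_apply] at h2
    simpa only [sq] using h2
  have key := AcdcDesign.design_integrals (θ := θ) (UnitAddTorus.mFourier _).continuous hGc he₂ he₄
    hn (fun x => hGinv _ x) (fun x => hGinv _ x) hG0
  subst hΦd hΨd hCd hSd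
  exact ⟨key.1, key.2.1, key.2.2.1, key.2.2.2.1, key.2.2.2.2, AcdcDesign.integral_norm_sq_pos hGc hne⟩

end Summit.AnomalousDissipation.AnomalousDissipation.Theorems

end
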